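import Summits.QuantumFields.BalabanUV.Beta.GAN24.WoodburyFibreZeroModeGain

/-!
# GAN24 / WoodburyFibreZeroModeOsc — the OSCILLATION INPUT of the zero-mode gain: a forward-difference bound `ε` on a leg gives
# `Decays (J − blockRef N J)` and `Decays (J − contourRef N J)` with constant `∝ (N − 1)·ε`
# (census row V14 of `HOME/b2b-balaban-gan24-p3/WOODBURY-FIBRE.md` v8, companion of `GAN24/WoodburyFibreZeroModeGain`; binder row G-an2-4 ∕ (CONV-C), P3, gen 8)

Cell `pub-balaban`, β sub-cell.  HONEST FRAMING (verbatim): discharging `BetaPertH` makes Bałaban's UV stability UNCONDITIONAL — a real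
constructive-QFT result; it is NOT the continuum limit and NOT the Clay problem.  HONEST DEPENDENCY (verbatim): continuum YM on T⁴ ⇐
BetaPertH ∧ nine spine estimates (0/9 proved); BetaPertH ⇐ (D1) ∧ (D4) ∧ CAP+tail; G-an2-4 gates asym, D1 and NE2/3/4.  NOT IN PRINT; OUR
BOOKKEEPING.  [folklore] real analysis on `ℤ^D` (telescoping along lattice paths, the triangle inequality in `ℓ¹`); cites nothing, mints no
`def … : Prop`, instantiates no wall binder.  This is the «discrete-gradient bound on the soft composite legs» half of the W∕T₂-slot planning
note (journal 2026-08-20 l.6956, (Q1)) turned into the exact hypothesis shape of `WoodburyFibreZeroModeGain`: it says NOTHING about which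
legs of the W-slot obey such a bound or with which `ε` (for a level-`n`-smooth leg read on the level-`m` lattice one expects `ε ~ Lc^{−(n−m)}`
— the consumer's input).  Discharges NOTHING of (CONV-C), the W-slot, «T2Shape», (D1); NEVER «G-an2-4 closed»; NOT BetaPertH, NOT continuum,
NOT Clay.

## Contents (all [folklore])
* §O1 WALKS: `l1_natCast_smul_unitVec`, `exp_weight_shift` (`e^{−δ|y+v−z|₁} ≤ e^{δ|v|₁}e^{−δ|y−z|₁}`), `mul_exp_mono`; **`abs_sub_axis`**
  (`|g(y + e_μ) − g(y)| ≤ ε·e^{−δ|y−z|₁}` ∀ μ, y ⇒ `|g(y + t e_μ) − g(y)| ≤ t·ε·e^{δt}·e^{−δ|y−z|₁}`), `partOff` ∕ `partOff_insert` ∕ `partOff_univ` ∕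
  `l1_partOff`, **`abs_sub_partOff`** (induction on the set of coordinates), `abs_sub_toSite`.
* §O2 BLOCKS: `blockOff` (`N•quo_N y + toSite (blockOff N y) = y`, entries `≤ N − 1`, `toSite_blockOff = LatticeForm.red`), `abs_sub_of_offset`
  (`c + toSite r = y`, `Σ r ≤ Λ` ⇒ `|g y − g c| ≤ Λ·ε·e^{2δΛ}·e^{−δ|y−z|₁}`), **`decays_sub_blockRef`** ∕ **`decays_sub_blockRefL`**:
  `Decays (J − blockRef N J) (D(N−1)·ε·e^{2δD(N−1)}) δ`.
* §O3 CONTOURS (fibre `Fib d`): `contourOff`, `zsmul_quo_add_contourOff`, `sum_contourOff_le` (`≤ (d+2)(N−1)`), `sub_contourRef_inl` (the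
  difference is the average of the `N` reference differences), **`decays_sub_contourRef`** ∕ **`decays_sub_contourRefL`**:
  `Decays (J − contourRef N J) ((d+2)(N−1)·ε·e^{2δ(d+2)(N−1)}) δ` (multiplier rows contribute `0`).
With `WoodburyFibreZeroModeGainKInv.decays_comp_ffKInv_right` this gives, for a right leg with forward differences `≤ ε·e^{−δ|·|₁}`:
`Decays (Γ_N^{ff} ∘ J) (|Fib d|·C_Γ·(d+2)(N−1)·ε·e^{2δ(d+2)(N−1)}·Zl(δ−δ′)) δ′` — linear in `(N−1)·ε`, the announced gain.
-/

noncomputable section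

open Finset
open scoped BigOperators
open Literature.MathematicalPhysics.QuantumFieldTheory
open Literature.MathematicalPhysics.QuantumFieldTheory.Balaban1983to89
open Literature.MathematicalPhysics.QuantumFieldTheory.Balaban1983to89.Beta
open B12Sec2to5 (l1 l1_nonneg)
open ExpKernelCalculus (MKer Decays)
open AffineAveraging (toSite unitVec)
open LatticeForm (quo)
open OneStepResolventKernel (Fib)
open Summit.QuantumFields.BalabanUV.Beta.GAN24.WoodburyFibreZeroModeGain

namespace Summit.QuantumFields.BalabanUV.Beta.GAN24.WoodburyFibreZeroModeOsc

/-! ## §O1 Walks: a forward-difference bound integrates along lattice paths -/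

section Walk

variable {D : ℕ}

/-- `|t • e_μ|₁ = t`. [folklore] -/
theorem l1_natCast_smul_unitVec (t : ℕ) (μ : Fin D) : l1 ((t : ℤ) • unitVec μ) = t := by
  simp only [l1, Pi.smul_apply, AffineAveraging.unitVec_apply, smul_eq_mul]
  rw [Finset.sum_eq_single μ (fun j _ hj => by simp [hj]) (fun h => (h (Finset.mem_univ μ)).elim)]
  simp

/-- Moving the base point by `v` costs at most `e^{δ|v|₁}` in an exponential weight (`δ ≥ 0`). [folklore] -/
theorem exp_weight_shift {δ : ℝ} (hδ : 0 ≤ δ) (y v z : Fin D → ℤ) :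
    Real.exp (-δ * l1 (y + v - z)) ≤ Real.exp (δ * l1 v) * Real.exp (-δ * l1 (y - z)) := by
  rw [← Real.exp_add, Real.exp_le_exp]
  have ht := ExpKernelCalculus.l1_sub_triangle y (y + v) z
  rw [show y - (y + v) = -v by abel, OneStepKernelFamily.l1_neg_eq] at ht
  nlinarith [l1_nonneg v, l1_nonneg (y - z)]

/-- `t ↦ t·e^{δt}` is monotone on `t ≥ 0` (`δ ≥ 0`). [folklore] -/
theorem mul_exp_mono {δ s t : ℝ} (hδ : 0 ≤ δ) (hs : 0 ≤ s) (hst : s ≤ t) : s * Real.exp (δ * s) ≤ t * Real.exp (δ * t) :=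
  mul_le_mul hst (Real.exp_le_exp.mpr (by nlinarith)) (Real.exp_pos _).le (hs.trans hst)

/-- **ONE-AXIS WALK**: a forward-difference bound `|g(y + e_μ) − g(y)| ≤ ε·e^{−δ|y − z|₁}` (all `μ`, `y`) gives
`|g(y + t e_μ) − g(y)| ≤ t·ε·e^{δt}·e^{−δ|y − z|₁}`. [folklore] -/
theorem abs_sub_axis {g : (Fin D → ℤ) → ℝ} {ε δ : ℝ} {z : Fin D → ℤ} (hε : 0 ≤ ε) (hδ : 0 ≤ δ)
    (hD : ∀ μ y, |g (y + unitVec μ) - g y| ≤ ε * Real.exp (-δ * l1 (y - z))) (μ : Fin D) (y : Fin D → ℤ) (t : ℕ) :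
    |g (y + (t : ℤ) • unitVec μ) - g y| ≤ t * ε * Real.exp (δ * t) * Real.exp (-δ * l1 (y - z)) := by
  induction t with
  | zero => simp
  | succ t ih =>
      have hstep := hD μ (y + (t : ℤ) • unitVec μ)
      have hw := exp_weight_shift hδ y ((t : ℤ) • unitVec μ) z
      rw [l1_natCast_smul_unitVec] at hw
      have e1 : y + ((t + 1 : ℕ) : ℤ) • unitVec μ = y + (t : ℤ) • unitVec μ + unitVec μ := by
        rw [Nat.cast_succ, add_smul, one_smul, add_assoc]
      rw [e1]
      have hE : 0 ≤ Real.exp (-δ * l1 (y - z)) := (Real.exp_pos _).le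
      have het : Real.exp (δ * t) ≤ Real.exp (δ * ((t + 1 : ℕ) : ℝ)) := Real.exp_le_exp.mpr (by push_cast; nlinarith)
      calc |g (y + (t : ℤ) • unitVec μ + unitVec μ) - g y|
          = |(g (y + (t : ℤ) • unitVec μ + unitVec μ) - g (y + (t : ℤ) • unitVec μ)) + (g (y + (t : ℤ) • unitVec μ) - g y)| := by
            ring_nf
        _ ≤ |g (y + (t : ℤ) • unitVec μ + unitVec μ) - g (y + (t : ℤ) • unitVec μ)| + |g (y + (t : ℤ) • unitVec μ) - g y| :=
            abs_add_le _ _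
        _ ≤ ε * (Real.exp (δ * t) * Real.exp (-δ * l1 (y - z))) + t * ε * Real.exp (δ * t) * Real.exp (-δ * l1 (y - z)) :=
            add_le_add (hstep.trans (mul_le_mul_of_nonneg_left hw hε)) ih
        _ = ((t + 1 : ℕ) : ℝ) * ε * Real.exp (δ * t) * Real.exp (-δ * l1 (y - z)) := by push_cast; ring
        _ ≤ ((t + 1 : ℕ) : ℝ) * ε * Real.exp (δ * ((t + 1 : ℕ) : ℝ)) * Real.exp (-δ * l1 (y - z)) := by
            refine mul_le_mul_of_nonneg_right (mul_le_mul_of_nonneg_left het (by positivity)) hE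

/-- The partial offset of `r : Fin D → ℕ` along the coordinates in `S`. [folklore] -/
def partOff (r : Fin D → ℕ) (S : Finset (Fin D)) : Fin D → ℤ := fun j => if j ∈ S then (r j : ℤ) else 0

/-- `partOff r (insert μ S) = partOff r S + r_μ e_μ` for `μ ∉ S`. [folklore] -/
theorem partOff_insert (r : Fin D → ℕ) {S : Finset (Fin D)} {μ : Fin D} (hμ : μ ∉ S) :
    partOff r (insert μ S) = partOff r S + ((r μ : ℕ) : ℤ) • unitVec μ := by
  funext j
  by_cases hj : j = μ
  · subst hj
    simp [partOff, hμ]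
  · simp [partOff, Finset.mem_insert, hj]

/-- `partOff r univ = toSite r`. [folklore] -/
theorem partOff_univ (r : Fin D → ℕ) : partOff r Finset.univ = toSite r := by
  funext j; simp [partOff, toSite]

/-- `|partOff r S|₁ = Σ_{j ∈ S} r_j`. [folklore] -/
theorem l1_partOff (r : Fin D → ℕ) (S : Finset (Fin D)) : l1 (partOff r S) = ∑ j ∈ S, (r j : ℝ) := by
  simp only [l1, partOff]
  rw [← Finset.sum_filter_add_sum_filter_not Finset.univ (fun j => j ∈ S)]
  rw [Finset.filter_mem_eq_inter, Finset.univ_inter]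
  have h2 : ∑ j ∈ Finset.univ.filter (fun j => ¬ j ∈ S), |(((if j ∈ S then (r j : ℤ) else 0) : ℤ) : ℝ)| = 0 :=
    Finset.sum_eq_zero fun j hj => by
      rw [Finset.mem_filter] at hj
      simp [hj.2]
  rw [h2, add_zero]
  refine Finset.sum_congr rfl fun j hj => ?_
  simp [hj]

/-- **MULTI-AXIS WALK** (induction on the set of coordinates): `|g(y + partOff r S) − g(y)| ≤ σ_S·ε·e^{δσ_S}·e^{−δ|y − z|₁}` with
`σ_S = Σ_{j∈S} r_j`. [folklore] -/
theorem abs_sub_partOff {g : (Fin D → ℤ) → ℝ} {ε δ : ℝ} {z : Fin D → ℤ} (hε : 0 ≤ ε) (hδ : 0 ≤ δ)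
    (hD : ∀ μ y, |g (y + unitVec μ) - g y| ≤ ε * Real.exp (-δ * l1 (y - z))) (y : Fin D → ℤ) (r : Fin D → ℕ)
    (S : Finset (Fin D)) :
    |g (y + partOff r S) - g y| ≤ (∑ j ∈ S, (r j : ℝ)) * ε * Real.exp (δ * ∑ j ∈ S, (r j : ℝ)) * Real.exp (-δ * l1 (y - z)) := by
  classical
  induction S using Finset.induction_on with
  | empty =>
      have : partOff r (∅ : Finset (Fin D)) = 0 := by funext j; simp [partOff]
      simp [this]
  | @insert μ S hμ ih =>
      rw [partOff_insert r hμ, Finset.sum_insert hμ, ← add_assoc]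
      set σ : ℝ := ∑ j ∈ S, (r j : ℝ) with hσ
      have hσ0 : 0 ≤ σ := Finset.sum_nonneg fun j _ => Nat.cast_nonneg _
      have hE : 0 ≤ Real.exp (-δ * l1 (y - z)) := (Real.exp_pos _).le
      have hax := abs_sub_axis hε hδ hD μ (y + partOff r S) (r μ)
      have hw := exp_weight_shift hδ y (partOff r S) z
      rw [l1_partOff] at hw
      have h1 : |g (y + partOff r S + ((r μ : ℕ) : ℤ) • unitVec μ) - g (y + partOff r S)|
          ≤ (r μ : ℝ) * ε * Real.exp (δ * ((r μ : ℝ) + σ)) * Real.exp (-δ * l1 (y - z)) := by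
        refine hax.trans ?_
        calc (r μ : ℝ) * ε * Real.exp (δ * (r μ : ℝ)) * Real.exp (-δ * l1 (y + partOff r S - z))
            ≤ (r μ : ℝ) * ε * Real.exp (δ * (r μ : ℝ)) * (Real.exp (δ * σ) * Real.exp (-δ * l1 (y - z))) :=
              mul_le_mul_of_nonneg_left hw (by positivity)
          _ = (r μ : ℝ) * ε * Real.exp (δ * ((r μ : ℝ) + σ)) * Real.exp (-δ * l1 (y - z)) := by
              rw [show δ * ((r μ : ℝ) + σ) = δ * (r μ : ℝ) + δ * σ by ring, Real.exp_add]; ring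
      have h2 : |g (y + partOff r S) - g y| ≤ σ * ε * Real.exp (δ * ((r μ : ℝ) + σ)) * Real.exp (-δ * l1 (y - z)) := by
        refine ih.trans ?_
        have : Real.exp (δ * σ) ≤ Real.exp (δ * ((r μ : ℝ) + σ)) := Real.exp_le_exp.mpr (by nlinarith [Nat.cast_nonneg (α := ℝ) (r μ)])
        exact mul_le_mul_of_nonneg_right (mul_le_mul_of_nonneg_left this (by positivity)) hE
      calc |g (y + partOff r S + ((r μ : ℕ) : ℤ) • unitVec μ) - g y|
          = |(g (y + partOff r S + ((r μ : ℕ) : ℤ) • unitVec μ) - g (y + partOff r S)) + (g (y + partOff r S) - g y)| := by ring_nf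
        _ ≤ _ := abs_add_le _ _
        _ ≤ (r μ : ℝ) * ε * Real.exp (δ * ((r μ : ℝ) + σ)) * Real.exp (-δ * l1 (y - z))
              + σ * ε * Real.exp (δ * ((r μ : ℝ) + σ)) * Real.exp (-δ * l1 (y - z)) := add_le_add h1 h2
        _ = ((r μ : ℝ) + σ) * ε * Real.exp (δ * ((r μ : ℝ) + σ)) * Real.exp (-δ * l1 (y - z)) := by ring

/-- **FULL OFFSET WALK with a uniform bound**: `r_j ≤ R` for all `j` ⇒ `|g(y + toSite r) − g(y)| ≤ (D·R)·ε·e^{δ·D·R}·e^{−δ|y − z|₁}`. [folklore] -/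
theorem abs_sub_toSite {g : (Fin D → ℤ) → ℝ} {ε δ : ℝ} {z : Fin D → ℤ} (hε : 0 ≤ ε) (hδ : 0 ≤ δ)
    (hD : ∀ μ y, |g (y + unitVec μ) - g y| ≤ ε * Real.exp (-δ * l1 (y - z))) (y : Fin D → ℤ) {r : Fin D → ℕ} {R : ℝ}
    (hr : ∀ j, (r j : ℝ) ≤ R) :
    |g (y + toSite r) - g y| ≤ (D * R) * ε * Real.exp (δ * (D * R)) * Real.exp (-δ * l1 (y - z)) := by
  classical
  have h := abs_sub_partOff hε hδ hD y r Finset.univ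
  rw [partOff_univ] at h
  refine h.trans ?_
  have hσ0 : 0 ≤ ∑ j, (r j : ℝ) := Finset.sum_nonneg fun j _ => Nat.cast_nonneg _
  have hσ : ∑ j, (r j : ℝ) ≤ D * R := by
    calc ∑ j, (r j : ℝ) ≤ ∑ _j : Fin D, R := Finset.sum_le_sum fun j _ => hr j
      _ = D * R := by rw [Finset.sum_const, Finset.card_univ, Fintype.card_fin, nsmul_eq_mul]
  have hm := mul_exp_mono hδ hσ0 hσ
  calc (∑ j, (r j : ℝ)) * ε * Real.exp (δ * ∑ j, (r j : ℝ)) * Real.exp (-δ * l1 (y - z))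
      = ((∑ j, (r j : ℝ)) * Real.exp (δ * ∑ j, (r j : ℝ))) * (ε * Real.exp (-δ * l1 (y - z))) := by ring
    _ ≤ ((D * R) * Real.exp (δ * (D * R))) * (ε * Real.exp (-δ * l1 (y - z))) := mul_le_mul_of_nonneg_right hm (by positivity)
    _ = (D * R) * ε * Real.exp (δ * (D * R)) * Real.exp (-δ * l1 (y - z)) := by ring

end Walk

/-! ## §O2 Oscillation over the blocks: `J − blockRef N J` from a forward-difference bound -/

section BlockOsc

variable {D : ℕ} {F : Type*} {N : ℕ} [NeZero N]

/-- The in-block offset of `y` as a vector of naturals: `y = N•quo_N y + toSite (blockOff N y)`, entries `≤ N − 1`. [folklore] -/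
def blockOff (N : ℕ) (y : Fin D → ℤ) : Fin D → ℕ := fun j => (y j % (N : ℤ)).toNat

omit [NeZero N] in
/-- `toSite (blockOff N y) = red N y` (the coordinatewise remainder) for `N ≠ 0`. [folklore] -/
theorem toSite_blockOff (hN : N ≠ 0) (y : Fin D → ℤ) : toSite (blockOff N y) = LatticeForm.red N y := by
  funext j
  have hN' : (N : ℤ) ≠ 0 := by exact_mod_cast hN
  simp only [toSite, blockOff, LatticeForm.red]
  exact Int.toNat_of_nonneg (Int.emod_nonneg _ hN')

/-- `N•quo_N y + toSite (blockOff N y) = y`. [folklore] -/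
theorem zsmul_quo_add_blockOff (y : Fin D → ℤ) : (N : ℤ) • quo N y + toSite (blockOff N y) = y := by
  rw [toSite_blockOff (NeZero.ne N), add_comm]
  exact LatticeForm.red_add_smul_quo N y

/-- Entries of the in-block offset are `≤ N − 1`. [folklore] -/
theorem blockOff_le (y : Fin D → ℤ) (j : Fin D) : ((blockOff N y j : ℕ) : ℝ) ≤ (N : ℝ) - 1 := by
  have hN : (0 : ℤ) < N := by exact_mod_cast Nat.pos_of_ne_zero (NeZero.ne N)
  have h1 : ((blockOff N y j : ℕ) : ℤ) = y j % (N : ℤ) := by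
    simp only [blockOff]; exact Int.toNat_of_nonneg (Int.emod_nonneg _ hN.ne')
  have h2 : y j % (N : ℤ) < N := Int.emod_lt_of_pos _ hN
  have h3 : ((blockOff N y j : ℕ) : ℤ) ≤ (N : ℤ) - 1 := by omega
  exact_mod_cast h3

/-- Entries of the in-block offset sum to at most `D(N − 1)`. [folklore] -/
theorem sum_blockOff_le (y : Fin D → ℤ) : ∑ j, ((blockOff N y j : ℕ) : ℝ) ≤ D * ((N : ℝ) - 1) := by
  calc ∑ j, ((blockOff N y j : ℕ) : ℝ) ≤ ∑ _j : Fin D, ((N : ℝ) - 1) := Finset.sum_le_sum fun j _ => blockOff_le (N := N) y j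
    _ = D * ((N : ℝ) - 1) := by rw [Finset.sum_const, Finset.card_univ, Fintype.card_fin, nsmul_eq_mul]

omit [NeZero N] in
/-- **WALK TO A REFERENCE POINT**: if `c + toSite r = y` with `Σ_j r_j ≤ Λ`, a forward-difference bound `ε` (weight `e^{−δ|· − z|₁}`) gives
`|g y − g c| ≤ Λ·ε·e^{2δΛ}·e^{−δ|y − z|₁}` (one factor `e^{δΛ}` from the walk, one from re-centring the weight at `y`). [folklore] -/
theorem abs_sub_of_offset {g : (Fin D → ℤ) → ℝ} {ε δ : ℝ} {z : Fin D → ℤ} (hε : 0 ≤ ε) (hδ : 0 ≤ δ)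
    (hD : ∀ μ y, |g (y + unitVec μ) - g y| ≤ ε * Real.exp (-δ * l1 (y - z))) {y c : Fin D → ℤ} {r : Fin D → ℕ}
    (hy : c + toSite r = y) {Λ : ℝ} (hΛ : ∑ j, (r j : ℝ) ≤ Λ) :
    |g y - g c| ≤ Λ * ε * Real.exp (2 * δ * Λ) * Real.exp (-δ * l1 (y - z)) := by
  classical
  have hwalk := abs_sub_partOff hε hδ hD c r Finset.univ
  rw [partOff_univ, hy] at hwalk
  set σ : ℝ := ∑ j, (r j : ℝ) with hσ
  have hσ0 : 0 ≤ σ := Finset.sum_nonneg fun j _ => Nat.cast_nonneg _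
  have hcy : l1 (c - y) = σ := by
    have e : c - y = -toSite r := by rw [eq_sub_of_add_eq hy]; abel
    rw [e, OneStepKernelFamily.l1_neg_eq, ← partOff_univ, l1_partOff]
  have hcz : Real.exp (-δ * l1 (c - z)) ≤ Real.exp (δ * Λ) * Real.exp (-δ * l1 (y - z)) := by
    have := exp_weight_shift hδ y (c - y) z
    rw [show y + (c - y) = c by abel, hcy] at this
    exact this.trans (mul_le_mul_of_nonneg_right (Real.exp_le_exp.mpr (by nlinarith)) (Real.exp_pos _).le)
  have hm := mul_exp_mono hδ hσ0 hΛ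
  calc |g y - g c| ≤ σ * ε * Real.exp (δ * σ) * Real.exp (-δ * l1 (c - z)) := hwalk
    _ = (σ * Real.exp (δ * σ)) * ε * Real.exp (-δ * l1 (c - z)) := by ring
    _ ≤ (Λ * Real.exp (δ * Λ)) * ε * (Real.exp (δ * Λ) * Real.exp (-δ * l1 (y - z))) :=
        mul_le_mul (mul_le_mul_of_nonneg_right hm hε) hcz (Real.exp_pos _).le
          (mul_nonneg (mul_nonneg (hσ0.trans hΛ) (Real.exp_pos _).le) hε)
    _ = Λ * ε * Real.exp (2 * δ * Λ) * Real.exp (-δ * l1 (y - z)) := by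
        rw [show 2 * δ * Λ = δ * Λ + δ * Λ by ring, Real.exp_add]; ring

/-- **OSCILLATION OVER THE BLOCKS (right leg)**: a forward-difference bound `ε` on the first variable of `J` (weight `e^{−δ|y − z|₁}`)
gives `Decays (J − blockRef N J) (D(N−1)·ε·e^{2δD(N−1)}) δ`. [folklore] -/
theorem decays_sub_blockRef {J : MKer D F} {ε δ : ℝ} (hε : 0 ≤ ε) (hδ : 0 ≤ δ)
    (hD : ∀ μ y z f b, |J (y + unitVec μ) z f b - J y z f b| ≤ ε * Real.exp (-δ * l1 (y - z))) :
    Decays (J - blockRef N J) ((D * ((N : ℝ) - 1)) * ε * Real.exp (2 * δ * (D * ((N : ℝ) - 1)))) δ := by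
  intro y z f b
  exact abs_sub_of_offset (g := fun w => J w z f b) hε hδ (fun μ w => hD μ w z f b) (zsmul_quo_add_blockOff (N := N) y)
    (sum_blockOff_le (N := N) y)

/-- **OSCILLATION OVER THE BLOCKS (left leg)**: a forward-difference bound `ε` on the second variable of `A` (weight `e^{−δ|x − y|₁}`)
gives `Decays (A − blockRefL N A) (D(N−1)·ε·e^{2δD(N−1)}) δ`. [folklore] -/
theorem decays_sub_blockRefL {A : MKer D F} {ε δ : ℝ} (hε : 0 ≤ ε) (hδ : 0 ≤ δ)
    (hD : ∀ μ x y a f, |A x (y + unitVec μ) a f - A x y a f| ≤ ε * Real.exp (-δ * l1 (x - y))) :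
    Decays (A - blockRefL N A) ((D * ((N : ℝ) - 1)) * ε * Real.exp (2 * δ * (D * ((N : ℝ) - 1)))) δ := by
  intro x y a f
  have h := abs_sub_of_offset (g := fun w => A x w a f) (z := x) hε hδ
    (fun μ w => by rw [ExpKernelCalculus.l1_sub_symm]; exact hD μ x w a f) (zsmul_quo_add_blockOff (N := N) y)
    (sum_blockOff_le (N := N) y)
  rw [ExpKernelCalculus.l1_sub_symm] at h
  exact h

end BlockOsc

/-! ## §O3 Oscillation over Bałaban's straight contours: `J − contourRef N J` from a forward-difference bound -/

section ContourOsc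

variable {d : ℕ} {N : ℕ} [NeZero N]

/-- The contour offset: `N•quo_N (y − s e_κ) + toSite (contourOff N y κ s) = y`. [folklore] -/
def contourOff (N : ℕ) (y : Fin (d + 1) → ℤ) (κ : Fin (d + 1)) (s : ℕ) : Fin (d + 1) → ℕ :=
  fun j => blockOff N (y - (s : ℤ) • unitVec κ) j + if j = κ then s else 0

/-- The reference point of the contour quasi-interpolant plus its offset is the fine point. [folklore] -/
theorem zsmul_quo_add_contourOff (y : Fin (d + 1) → ℤ) (κ : Fin (d + 1)) (s : ℕ) :
    (N : ℤ) • quo N (y - (s : ℤ) • unitVec κ) + toSite (contourOff N y κ s) = y := by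
  have h := zsmul_quo_add_blockOff (N := N) (y - (s : ℤ) • unitVec κ)
  have e : toSite (contourOff N y κ s) = toSite (blockOff N (y - (s : ℤ) • unitVec κ)) + (s : ℤ) • unitVec κ := by
    funext j
    simp only [toSite, contourOff, Pi.add_apply, Pi.smul_apply, AffineAveraging.unitVec_apply, smul_eq_mul, Nat.cast_add,
      Nat.cast_ite, Nat.cast_zero, mul_ite, mul_one, mul_zero]
  rw [e, ← add_assoc, h, sub_add_cancel]

/-- Entries of the contour offset sum to at most `(d + 2)(N − 1)`. [folklore] -/
theorem sum_contourOff_le (y : Fin (d + 1) → ℤ) (κ : Fin (d + 1)) {s : ℕ} (hs : s ∈ Finset.range N) :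
    ∑ j, ((contourOff N y κ s j : ℕ) : ℝ) ≤ ((d : ℝ) + 2) * ((N : ℝ) - 1) := by
  have hsN : (s : ℝ) ≤ (N : ℝ) - 1 := by
    have : s + 1 ≤ N := Finset.mem_range.mp hs
    have : ((s + 1 : ℕ) : ℝ) ≤ N := by exact_mod_cast this
    push_cast at this; linarith
  simp only [contourOff, Nat.cast_add, Nat.cast_ite, Nat.cast_zero, Finset.sum_add_distrib, Finset.sum_ite_eq', Finset.mem_univ,
    if_true]
  have h1 := sum_blockOff_le (N := N) (y - (s : ℤ) • unitVec κ)
  push_cast at h1 ⊢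
  linarith

/-- The difference to the contour quasi-interpolant on a field row is the average of the differences to the `N` reference points. [folklore] -/
theorem sub_contourRef_inl (J : MKer (d + 1) (Fib d)) (y z : Fin (d + 1) → ℤ) (κ : Fin (d + 1)) (b : Fib d) :
    (J - contourRef N J) y z (Sum.inl κ) b
      = (N : ℝ)⁻¹ * ∑ s ∈ Finset.range N, (J y z (Sum.inl κ) b - J ((N : ℤ) • quo N (y - (s : ℤ) • unitVec κ)) z (Sum.inl κ) b) := by
  have hN : (N : ℝ) ≠ 0 := by exact_mod_cast NeZero.ne N
  simp only [Pi.sub_apply, contourRef]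
  rw [Finset.sum_sub_distrib, Finset.sum_const, Finset.card_range, nsmul_eq_mul, mul_sub, ← mul_assoc, inv_mul_cancel₀ hN, one_mul]

/-- **OSCILLATION OVER THE CONTOURS (right leg)**: a forward-difference bound `ε` on the first variable of `J` gives
`Decays (J − contourRef N J) ((d+2)(N−1)·ε·e^{2δ(d+2)(N−1)}) δ` (multiplier rows contribute `0`). [folklore] -/
theorem decays_sub_contourRef {J : MKer (d + 1) (Fib d)} {ε δ : ℝ} (hε : 0 ≤ ε) (hδ : 0 ≤ δ)
    (hD : ∀ μ y z f b, |J (y + unitVec μ) z f b - J y z f b| ≤ ε * Real.exp (-δ * l1 (y - z))) :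
    Decays (J - contourRef N J)
      ((((d : ℝ) + 2) * ((N : ℝ) - 1)) * ε * Real.exp (2 * δ * (((d : ℝ) + 2) * ((N : ℝ) - 1)))) δ := by
  intro y z f b
  have hN1 : (0 : ℝ) ≤ (N : ℝ) - 1 := by
    have : (1 : ℝ) ≤ N := by exact_mod_cast Nat.pos_of_ne_zero (NeZero.ne N)
    linarith
  cases f with
  | inr κ =>
      have h0 : (J - contourRef N J) y z (Sum.inr κ) b = 0 := by simp [contourRef]
      rw [h0, abs_zero]; positivity
  | inl κ =>
      rw [sub_contourRef_inl]
      exact abs_avg_le fun s hs => abs_sub_of_offset (g := fun w => J w z (Sum.inl κ) b) hε hδ (fun μ w => hD μ w z _ b)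
        (zsmul_quo_add_contourOff (N := N) y κ s) (sum_contourOff_le (N := N) y κ hs)

/-- The same on a field column of a left leg. [folklore] -/
theorem sub_contourRefL_inl (A : MKer (d + 1) (Fib d)) (x y : Fin (d + 1) → ℤ) (a : Fib d) (κ : Fin (d + 1)) :
    (A - contourRefL N A) x y a (Sum.inl κ)
      = (N : ℝ)⁻¹ * ∑ s ∈ Finset.range N, (A x y a (Sum.inl κ) - A x ((N : ℤ) • quo N (y - (s : ℤ) • unitVec κ)) a (Sum.inl κ)) := by
  have hN : (N : ℝ) ≠ 0 := by exact_mod_cast NeZero.ne N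
  simp only [Pi.sub_apply, contourRefL]
  rw [Finset.sum_sub_distrib, Finset.sum_const, Finset.card_range, nsmul_eq_mul, mul_sub, ← mul_assoc, inv_mul_cancel₀ hN, one_mul]

/-- **OSCILLATION OVER THE CONTOURS (left leg)**: a forward-difference bound `ε` on the second variable of `A` (weight `e^{−δ|x − y|₁}`)
gives `Decays (A − contourRefL N A) ((d+2)(N−1)·ε·e^{2δ(d+2)(N−1)}) δ`. [folklore] -/
theorem decays_sub_contourRefL {A : MKer (d + 1) (Fib d)} {ε δ : ℝ} (hε : 0 ≤ ε) (hδ : 0 ≤ δ)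
    (hD : ∀ μ x y a f, |A x (y + unitVec μ) a f - A x y a f| ≤ ε * Real.exp (-δ * l1 (x - y))) :
    Decays (A - contourRefL N A)
      ((((d : ℝ) + 2) * ((N : ℝ) - 1)) * ε * Real.exp (2 * δ * (((d : ℝ) + 2) * ((N : ℝ) - 1)))) δ := by
  intro x y a f
  have hN1 : (0 : ℝ) ≤ (N : ℝ) - 1 := by
    have : (1 : ℝ) ≤ N := by exact_mod_cast Nat.pos_of_ne_zero (NeZero.ne N)
    linarith
  cases f with
  | inr κ =>
      have h0 : (A - contourRefL N A) x y a (Sum.inr κ) = 0 := by simp [contourRefL]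
      rw [h0, abs_zero]; positivity
  | inl κ =>
      rw [sub_contourRefL_inl]
      refine abs_avg_le fun s hs => ?_
      have h := abs_sub_of_offset (g := fun w => A x w a (Sum.inl κ)) (z := x) hε hδ
        (fun μ w => by rw [ExpKernelCalculus.l1_sub_symm]; exact hD μ x w a _)
        (zsmul_quo_add_contourOff (N := N) y κ s) (sum_contourOff_le (N := N) y κ hs)
      rw [ExpKernelCalculus.l1_sub_symm] at h
      exact h

end ContourOsc

end Summit.QuantumFields.BalabanUV.Beta.GAN24.WoodburyFibreZeroModeOsc

end
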